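import Literature.MathematicalPhysics.QuantumFieldTheory.WilsonFinTorusTwistedPartitionSwap
import HarnessLib

/-!
# 't Hooft's full twist tensor on the anisotropic four-torus: the twisted Wilson functional integral `W{n_{μν}; a_μ}`
# with electric AND magnetic twists, and its covariance under axis exchange (the lattice form of (6.2))

Topic `Literature/MathematicalPhysics/QuantumFieldTheory`; sequel of `WilsonFinTorusTwistedPartition.lean` (the
TEMPORALLY twisted partition function `wilsonFinTorusTwistedPartition ρ β z n₀ n₁ n₂ n₃`: twist `z μ` on the stack
`{x_μ = 0, x₃ = 0}` of `(μ, 3)`-plaquettes, time = the last axis) and `WilsonFinTorusTwistedPartitionSwap.lean`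
(oriented cocycle, covariant axis relabelling, the temporal planes read along their spatial axis).

G. 't Hooft, Nucl. Phys. B 153 (1979) 141 (reprint C. Rebbi (ed.), *Lattice Gauge Theories and Monte Carlo
Simulations* (1983), pp. 546–561): §2 (2.5)–(2.6) «there are N⁶ distinct nongauge equivalent choices for the boundary
conditions. We can label these by giving the six integers n_{μν} … n_{4i} = n_i [electric twists k_i], n_{ij} = m_k
[magnetic] … W{n, m; a_μ} = C ∫_{{n,m}} DA exp S(A)»; §6 (6.1)–(6.2) «W will be invariant under joint rotations of a_μ
and n_{μν} in Euclidean space. In particular [under the rotation (6.1) exchanging the axes 1 ↔ 2 and 3 ↔ 4]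
W{k̃, k₃, m̃, m₃; ã, a₃, β} = W{m̃, k₃, k̃, m₃; â, β, a₃}» — the identity behind the duality equation (6.3).
J. Greensite, *An Introduction to the Confinement Problem* (2011) §4.4 (4.41)–(4.44): on the lattice a twist in the
plane `(μ, ν)` is the replacement `U_p ↦ z U_p` on ONE coclosed stack of `(μ, ν)`-plaquettes.

Here, on the `Fin`-box `n₀ × n₁ × n₂ × n₃` (axis `3` = Euclidean time of the companion files):

* `plaqTwistCocycle c` — the ORIENTED cocycle of an arbitrary plaquette-twist assignment
  `c : FinTorusSite → Fin 4 → Fin 4 → G` (read on the ordered pairs `μ < ν`, inverse on the reversed pairs);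
* `wilsonFinTorusPlaqTwistedPartition ρ β n₀ n₁ n₂ n₃ c := ∫ exp(−β Σ_x Σ_{μ<ν} (n − Re tr ρ(c_{x,μν} U_{x,μν}))) ∏ dU` —
  the Wilson integral with every plaquette `(x; μ, ν)`, `μ < ν`, multiplied by `c x μ ν ∈ G`
  (`wilsonFinTorusTwistedPartition_eq_plaqTwisted`: the temporal twist is the special case `c = tHooftTwistFactor z`, `rfl`);
* `tHooftTwistTensor z`, `z : Fin 4 → Fin 4 → G` — **'t Hooft's six twists**: `z μ ν` on the stack
  `{x_μ = 0, x_ν = 0}` of `(μ, ν)`-plaquettes, for every plane; `wilsonFinTorusTensorTwistedPartition ρ β z n₀ n₁ n₂ n₃` =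
  `W{n_{μν}; a_μ}` of (2.6) on the anisotropic lattice box (electric twists `z μ 3`, magnetic twists `z i j`, `i<j<3`);
  `temporalTwistTensor`, `wilsonFinTorusTensorTwistedPartition_temporal` — with no magnetic twist it IS the companion
  files' `wilsonFinTorusTwistedPartition` (same stacks);
* `wilsonFinTorusPlaqTwistedPartition_relabel`, `integral_mul_plaqTwistedWeight_relabel` — covariant axis relabelling
  for ARBITRARY plaquette twists (site bijection intertwining the shifts along an axis permutation + correspondence of the
  oriented cocycles), with and without an observable inserted; `wilsonFinTorusPlaqTwistedPartition_pos`;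
* ★ `wilsonFinTorusTensorTwistedPartition_swap03` — **the cube step mixes electric and magnetic twists**: exchanging the
  axes `0 ↔ 3` (reading the side `n₀` as Euclidean time), `W{z}(a,b,c,d) = W{swap03TwistTensor z}(d,b,c,a)` where the
  temporal twists of the planes `(1,3), (2,3)` become the MAGNETIC twists of the planes `(0,1), (0,2)` (inverted, by
  orientation) and conversely, the `(0,3)` twist is inverted and the `(1,2)` twist is kept — for every `z`, every compact
  `G`, continuous `ρ`, real `β` (no centrality needed: a change of variables);
* ★ `wilsonFinTorusTensorTwistedPartition_rotate` — **the lattice form of 't Hooft's (6.2)**: under the axis exchange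
  `0 ↔ 1`, `2 ↔ 3` (his rotation (6.1), `ã ↦ â`, `(a₃, β) ↦ (β, a₃)`), `W{z}(a,b,c,d) = W{rotateTwistTensor z}(b,a,d,c)`:
  the two transverse electric twists `z 0 3, z 1 3` and the two transverse magnetic twists `z 1 2, z 0 2` are EXCHANGED
  (`k̃ ↔ m̃`), the longitudinal ones `z 2 3`, `z 0 1` (`k₃`, `m₃`) are inverted.  ('t Hooft's printed (6.2) keeps `k₃, m₃`:
  his rotation (6.1) includes two coordinate reflections, which undo the two inversions for CENTRAL twists after relocating
  the stacks; for `ℤ₂`-valued twists — `SU(2)` — the statements coincide literally.)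

Everything is PROVED (change of variables in the product Haar integral; finite bookkeeping of the six planes); the
definitions have bodies.  HONEST FRAMING: identities between finite-box integrals; nothing here is an estimate, a flux
free energy bound, the duality EQUATION (6.3) (which needs the flux Fourier transform over central twists on top of this
covariance), confinement or a mass gap.

References: 't Hooft 1979 §2 (2.5)–(2.6), §6 (6.1)–(6.2); Greensite 2011 §4.4 (4.41)–(4.44); I. Montvay, G. Münster,
*Quantum Fields on a Lattice* (1994) §3.2.6 (3.145).
-/

noncomputable section

open scoped BigOperators
open MeasureTheory Finset
open Literature.RepresentationTheory.CompactGroups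

namespace Literature.MathematicalPhysics.QuantumFieldTheory

variable {G : Type*} [Group G] {n : ℕ}

/-! ### Plaquette twists and their oriented cocycles (pure algebra) -/

section Algebra

/-- **The oriented cocycle of a plaquette-twist assignment** `c` (an element of `G` for every site and every ORDERED
pair of directions `μ < ν`): `c x μ ν` on `μ < ν`, `(c x ν μ)⁻¹` on `ν < μ`, `1` on the diagonal — 't Hooft's
antisymmetric twist tensor `n_{νμ} = −n_{μν}` for an arbitrary (not necessarily stack-shaped) assignment.
[cite: tHooft1979Flux, §2 (2.5)–(2.6)] -/
def plaqTwistCocycle {n₀ n₁ n₂ n₃ : ℕ} (c : FinTorusSite n₀ n₁ n₂ n₃ → Fin 4 → Fin 4 → G)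
    (x : FinTorusSite n₀ n₁ n₂ n₃) (μ ν : Fin 4) : G :=
  if μ < ν then c x μ ν else if ν < μ then (c x ν μ)⁻¹ else 1

/-- On the ordered pairs the cocycle is the twist. [cite: tHooft1979Flux, §2 (2.5)–(2.6)] -/
theorem plaqTwistCocycle_of_lt {n₀ n₁ n₂ n₃ : ℕ} (c : FinTorusSite n₀ n₁ n₂ n₃ → Fin 4 → Fin 4 → G)
    (x : FinTorusSite n₀ n₁ n₂ n₃) {μ ν : Fin 4} (h : μ < ν) : plaqTwistCocycle c x μ ν = c x μ ν := by
  simp [plaqTwistCocycle, h]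

/-- The cocycle is antisymmetric: `c(x; ν, μ) = c(x; μ, ν)⁻¹`. [cite: tHooft1979Flux, §2 (2.5)] -/
theorem plaqTwistCocycle_symm {n₀ n₁ n₂ n₃ : ℕ} (c : FinTorusSite n₀ n₁ n₂ n₃ → Fin 4 → Fin 4 → G)
    (x : FinTorusSite n₀ n₁ n₂ n₃) (μ ν : Fin 4) : plaqTwistCocycle c x ν μ = (plaqTwistCocycle c x μ ν)⁻¹ := by
  unfold plaqTwistCocycle
  rcases lt_trichotomy μ ν with h | h | h
  · simp [h, not_lt.2 h.le]
  · subst h; simp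
  · simp [h, not_lt.2 h.le]

/-- **'t Hooft's twist tensor**: the twist `z μ ν ∈ G` sits on the stack `{x_μ = 0, x_ν = 0}` of `(μ, ν)`-plaquettes
(all values of the two remaining coordinates) — one coclosed stack per plane, Greensite's (4.41)/(4.43); for the temporal
planes `(μ, 3)` this is exactly the stack of `tHooftTwistFactor`.  Only the entries `μ < ν` are ever read.
[cite: tHooft1979Flux, §2 (2.5)–(2.6)] [cite: Greensite2011, §4.4 (4.41)–(4.43)] -/
def tHooftTwistTensor (z : Fin 4 → Fin 4 → G) {n₀ n₁ n₂ n₃ : ℕ} (x : FinTorusSite n₀ n₁ n₂ n₃) (μ ν : Fin 4) : G :=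
  if finTorusSiteCoord x μ = 0 ∧ finTorusSiteCoord x ν = 0 then z μ ν else 1

/-- The twist tensor of a purely TEMPORAL twist family `zT : Fin 4 → G` (`zT μ` in the plane `(μ, 3)`): `zT μ` in the
entries `(μ, 3)`, `1` elsewhere ('t Hooft's `n_{4i} = k_i`, `n_{ij} = 0`). [cite: tHooft1979Flux, §2 (2.5)] -/
def temporalTwistTensor (zT : Fin 4 → G) : Fin 4 → Fin 4 → G := fun μ ν => if ν = 3 then zT μ else 1

/-- On ordered pairs the tensor of a temporal family reproduces the temporal twist factor of the companion file.
[cite: tHooft1979Flux, §2 (2.5)–(2.6)] -/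
theorem tHooftTwistTensor_temporal_of_lt (zT : Fin 4 → G) {n₀ n₁ n₂ n₃ : ℕ} (x : FinTorusSite n₀ n₁ n₂ n₃)
    {μ ν : Fin 4} (h : μ < ν) :
    tHooftTwistTensor (temporalTwistTensor zT) x μ ν = tHooftTwistFactor zT x μ ν := by
  unfold tHooftTwistTensor temporalTwistTensor tHooftTwistFactor
  by_cases hν : ν = 3
  · subst hν
    by_cases h1 : finTorusSiteCoord x μ = 0 <;> by_cases h2 : finTorusSiteCoord x 3 = 0 <;> simp [h1, h2]
  · simp [hν]

/-- **The twist tensor after the exchange of the axes `0 ↔ 3`** (the cube step: the side `n₀` read as time): the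
electric twists of the planes `(1,3), (2,3)` move to the magnetic planes `(0,1), (0,2)` and conversely, all inverted by
orientation, the `(0,3)` twist is inverted, the `(1,2)` twist is kept.  Entries `μ ≥ ν` are placeholders (`1`).
[cite: tHooft1979Flux, §6 (6.1)–(6.2)] -/
def swap03TwistTensor (z : Fin 4 → Fin 4 → G) : Fin 4 → Fin 4 → G :=
  ![![1, (z 1 3)⁻¹, (z 2 3)⁻¹, (z 0 3)⁻¹], ![1, 1, z 1 2, (z 0 1)⁻¹], ![1, 1, 1, (z 0 2)⁻¹], ![1, 1, 1, 1]]

/-- **The twist tensor after 't Hooft's rotation (6.1)** (axes `0 ↔ 1` and `2 ↔ 3` exchanged): the transverse electric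
twists `z 0 3, z 1 3` and the transverse magnetic twists `z 1 2, z 0 2` are exchanged (`k̃ ↔ m̃`), the longitudinal
electric twist `z 2 3` and magnetic twist `z 0 1` are inverted (orientation).  Entries `μ ≥ ν` are placeholders.
[cite: tHooft1979Flux, §6 (6.1)–(6.2)] -/
def rotateTwistTensor (z : Fin 4 → Fin 4 → G) : Fin 4 → Fin 4 → G :=
  ![![1, (z 0 1)⁻¹, z 1 3, z 1 2], ![1, 1, z 0 3, z 0 2], ![1, 1, 1, (z 2 3)⁻¹], ![1, 1, 1, 1]]

/-- The cube-step table is an involution on the read entries `μ < ν` (the axis exchange is one).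
[cite: tHooft1979Flux, §6 (6.1)–(6.2)] -/
theorem swap03TwistTensor_swap03TwistTensor (z : Fin 4 → Fin 4 → G) :
    swap03TwistTensor (swap03TwistTensor z) 0 1 = z 0 1 ∧ swap03TwistTensor (swap03TwistTensor z) 0 2 = z 0 2 ∧
      swap03TwistTensor (swap03TwistTensor z) 0 3 = z 0 3 ∧ swap03TwistTensor (swap03TwistTensor z) 1 2 = z 1 2 ∧
      swap03TwistTensor (swap03TwistTensor z) 1 3 = z 1 3 ∧ swap03TwistTensor (swap03TwistTensor z) 2 3 = z 2 3 := by
  simp [swap03TwistTensor]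

/-- The rotation table is an involution on the read entries `μ < ν`. [cite: tHooft1979Flux, §6 (6.1)–(6.2)] -/
theorem rotateTwistTensor_rotateTwistTensor (z : Fin 4 → Fin 4 → G) :
    rotateTwistTensor (rotateTwistTensor z) 0 1 = z 0 1 ∧ rotateTwistTensor (rotateTwistTensor z) 0 2 = z 0 2 ∧
      rotateTwistTensor (rotateTwistTensor z) 0 3 = z 0 3 ∧ rotateTwistTensor (rotateTwistTensor z) 1 2 = z 1 2 ∧
      rotateTwistTensor (rotateTwistTensor z) 1 3 = z 1 3 ∧ rotateTwistTensor (rotateTwistTensor z) 2 3 = z 2 3 := by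
  simp [rotateTwistTensor]

/-- Coordinates of the `0 ↔ 3` exchanged site. [folklore] -/
private theorem coord_swap03'' {a b c d : ℕ} (x : FinTorusSite a b c d) (μ : Fin 4) :
    finTorusSiteCoord ((x.2.2.2, x.2.1, x.2.2.1, x.1) : FinTorusSite d b c a) μ =
      finTorusSiteCoord x (Equiv.swap (0 : Fin 4) 3 μ) := by
  fin_cases μ <;> rfl

/-- Coordinates of the `0 ↔ 1`, `2 ↔ 3` exchanged site. [folklore] -/
private theorem coord_rotate {a b c d : ℕ} (x : FinTorusSite a b c d) (μ : Fin 4) :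
    finTorusSiteCoord ((x.2.1, x.1, x.2.2.2, x.2.2.1) : FinTorusSite b a d c) μ =
      finTorusSiteCoord x ((Equiv.swap (0 : Fin 4) 1 * Equiv.swap (2 : Fin 4) 3) μ) := by
  fin_cases μ <;> rfl

/-- **Cocycle correspondence for the cube step**: reading the twist tensor `swap03TwistTensor z` at the exchanged site
on the exchanged directions gives the oriented cocycle of `z`. [cite: tHooft1979Flux, §6 (6.1)–(6.2)] -/
theorem plaqTwistCocycle_swap03TwistTensor {a b c d : ℕ} (z : Fin 4 → Fin 4 → G) (x : FinTorusSite a b c d)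
    (μ ν : Fin 4) :
    plaqTwistCocycle (tHooftTwistTensor (swap03TwistTensor z))
        ((x.2.2.2, x.2.1, x.2.2.1, x.1) : FinTorusSite d b c a) (Equiv.swap (0 : Fin 4) 3 μ) (Equiv.swap (0 : Fin 4) 3 ν) =
      plaqTwistCocycle (tHooftTwistTensor z) x μ ν := by
  have hy := coord_swap03'' x
  by_cases h0 : finTorusSiteCoord x 0 = 0 <;> by_cases h1 : finTorusSiteCoord x 1 = 0 <;>
    by_cases h2 : finTorusSiteCoord x 2 = 0 <;> by_cases h3 : finTorusSiteCoord x 3 = 0 <;>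
      fin_cases μ <;> fin_cases ν <;>
        simp (config := { decide := true }) [plaqTwistCocycle, tHooftTwistTensor, swap03TwistTensor,
          Equiv.swap_apply_def, hy, h0, h1, h2, h3]

/-- **Cocycle correspondence for 't Hooft's rotation (6.1)**. [cite: tHooft1979Flux, §6 (6.1)–(6.2)] -/
theorem plaqTwistCocycle_rotateTwistTensor {a b c d : ℕ} (z : Fin 4 → Fin 4 → G) (x : FinTorusSite a b c d)
    (μ ν : Fin 4) :
    plaqTwistCocycle (tHooftTwistTensor (rotateTwistTensor z))
        ((x.2.1, x.1, x.2.2.2, x.2.2.1) : FinTorusSite b a d c)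
        ((Equiv.swap (0 : Fin 4) 1 * Equiv.swap (2 : Fin 4) 3) μ) ((Equiv.swap (0 : Fin 4) 1 * Equiv.swap (2 : Fin 4) 3) ν) =
      plaqTwistCocycle (tHooftTwistTensor z) x μ ν := by
  have hy := coord_rotate x
  by_cases h0 : finTorusSiteCoord x 0 = 0 <;> by_cases h1 : finTorusSiteCoord x 1 = 0 <;>
    by_cases h2 : finTorusSiteCoord x 2 = 0 <;> by_cases h3 : finTorusSiteCoord x 3 = 0 <;>
      fin_cases μ <;> fin_cases ν <;>
        simp (config := { decide := true }) [plaqTwistCocycle, tHooftTwistTensor, rotateTwistTensor,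
          Equiv.swap_apply_def, Equiv.Perm.mul_apply, hy, h0, h1, h2, h3]

/-- Plaquettes of a relabelled configuration. [folklore] -/
private theorem finTorusPlaquette_relabel'' {a b c d a' b' c' d' : ℕ}
    (e : FinTorusSite a b c d ≃ FinTorusSite a' b' c' d') (σ : Equiv.Perm (Fin 4))
    (he : ∀ x μ, e (x.shift μ) = (e x).shift (σ μ)) (U' : FinTorusSite a' b' c' d' × Fin 4 → G)
    (x : FinTorusSite a b c d) (μ ν : Fin 4) :
    finTorusPlaquette (fun l : FinTorusSite a b c d × Fin 4 => U' (e l.1, σ l.2)) x μ ν =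
      finTorusPlaquette U' (e x) (σ μ) (σ ν) := by
  simp only [finTorusPlaquette, he]

/-- The reversed plaquette is the inverse holonomy. [folklore] -/
private theorem finTorusPlaquette_symm'' {n₀ n₁ n₂ n₃ : ℕ} (U : FinTorusSite n₀ n₁ n₂ n₃ × Fin 4 → G)
    (x : FinTorusSite n₀ n₁ n₂ n₃) (μ ν : Fin 4) :
    finTorusPlaquette U x ν μ = (finTorusPlaquette U x μ ν)⁻¹ := by
  unfold finTorusPlaquette
  group

/-- The sum over the ordered pairs `μ < ν` of `Fin 4`, written out. [folklore] -/
private theorem sum_pairs_eq_six'' (g : Fin 4 → Fin 4 → ℝ) :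
    ∑ q : {q : Fin 4 × Fin 4 // q.1 < q.2}, g q.1.1 q.1.2 =
      g 0 1 + g 0 2 + g 0 3 + g 1 2 + g 1 3 + g 2 3 := by
  have h := Finset.sum_subtype (p := fun q : Fin 4 × Fin 4 => q.1 < q.2) (F := inferInstance)
    (Finset.univ.filter fun q : Fin 4 × Fin 4 => q.1 < q.2) (fun x => by simp)
    (fun q : Fin 4 × Fin 4 => g q.1 q.2)
  rw [← h, Finset.sum_filter, Fintype.sum_prod_type]
  simp (config := { decide := true }) only [Fin.sum_univ_four, Fin.isValue, ite_true, ite_false, add_zero,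
    zero_add, add_assoc]

/-- Twice the sum over pairs of a symmetric function is the off-diagonal sum. [folklore] -/
private theorem two_mul_sum_pairs'' (g : Fin 4 → Fin 4 → ℝ) (hg : ∀ μ ν, g ν μ = g μ ν) :
    2 * ∑ q : {q : Fin 4 × Fin 4 // q.1 < q.2}, g q.1.1 q.1.2 = (∑ μ, ∑ ν, g μ ν) - ∑ μ, g μ μ := by
  rw [sum_pairs_eq_six'' g]
  simp only [Fin.sum_univ_four]
  rw [hg 0 1, hg 0 2, hg 0 3, hg 1 2, hg 1 3, hg 2 3]
  ring

/-- The pair sum of a symmetric function is invariant under a permutation of the axes. [folklore] -/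
private theorem sum_pairs_perm'' (f : Fin 4 → Fin 4 → ℝ) (hf : ∀ μ ν, f ν μ = f μ ν) (σ : Equiv.Perm (Fin 4)) :
    ∑ q : {q : Fin 4 × Fin 4 // q.1 < q.2}, f (σ q.1.1) (σ q.1.2) =
      ∑ q : {q : Fin 4 × Fin 4 // q.1 < q.2}, f q.1.1 q.1.2 := by
  have h1 : 2 * ∑ q : {q : Fin 4 × Fin 4 // q.1 < q.2}, f (σ q.1.1) (σ q.1.2) =
      (∑ μ, ∑ ν, f (σ μ) (σ ν)) - ∑ μ, f (σ μ) (σ μ) :=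
    two_mul_sum_pairs'' (fun μ ν => f (σ μ) (σ ν)) (fun μ ν => hf (σ μ) (σ ν))
  have h2 := two_mul_sum_pairs'' f hf
  have h3 : (∑ μ, ∑ ν, f (σ μ) (σ ν)) = ∑ μ, ∑ ν, f μ ν :=
    calc (∑ μ, ∑ ν, f (σ μ) (σ ν)) = ∑ μ, ∑ ν, f μ (σ ν) :=
          Equiv.sum_comp σ (fun μ => ∑ ν, f μ (σ ν))
      _ = ∑ μ, ∑ ν, f μ ν := Finset.sum_congr rfl fun μ _ => Equiv.sum_comp σ (f μ)
  have h4 : (∑ μ, f (σ μ) (σ μ)) = ∑ μ, f μ μ := Equiv.sum_comp σ (fun μ => f μ μ)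
  linarith

/-- **For `ℤ₂`-valued twists the lattice (6.2) is literal**: if every twist squares to one (`z μ ν = (z μ ν)⁻¹`, e.g. the
centre of `SU(2)`), the rotated tensor is the plain exchange `k̃ ↔ m̃` with `k₃, m₃` unchanged on the read entries.
[cite: tHooft1979Flux, §6 (6.2)] -/
theorem rotateTwistTensor_of_inv_eq (z : Fin 4 → Fin 4 → G) (hz : ∀ μ ν, (z μ ν)⁻¹ = z μ ν) :
    rotateTwistTensor z 0 1 = z 0 1 ∧ rotateTwistTensor z 0 2 = z 1 3 ∧ rotateTwistTensor z 0 3 = z 1 2 ∧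
      rotateTwistTensor z 1 2 = z 0 3 ∧ rotateTwistTensor z 1 3 = z 0 2 ∧ rotateTwistTensor z 2 3 = z 2 3 := by
  simp [rotateTwistTensor, hz]

end Algebra

/-! ### The Wilson integral with an arbitrary plaquette twist -/

section Partition

variable (ρ : G →* Matrix (Fin n) (Fin n) ℂ) [TopologicalSpace G] [IsTopologicalGroup G] [CompactSpace G]
  [MeasurableSpace G] [BorelSpace G]

/-- **The Wilson partition function of the box `n₀ × n₁ × n₂ × n₃` with an arbitrary plaquette twist** `c`:
`Z^{c}_{ρ,β} = ∫ exp(−β Σ_x Σ_{μ<ν} (n − Re tr ρ(c_{x,μν} · U_{x,μν}))) ∏ dHaar` — VERBATIM the companion files'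
`wilsonFinTorusTwistedPartition` with `tHooftTwistFactor z` replaced by `c`. [cite: tHooft1979Flux, §2 (2.6)]
[cite: Greensite2011, §4.4 (4.44)] -/
def wilsonFinTorusPlaqTwistedPartition (β : ℝ) (n₀ n₁ n₂ n₃ : ℕ)
    (c : FinTorusSite n₀ n₁ n₂ n₃ → Fin 4 → Fin 4 → G) : ℝ :=
  ∫ U, Real.exp (-β * ∑ x : FinTorusSite n₀ n₁ n₂ n₃, ∑ q : {q : Fin 4 × Fin 4 // q.1 < q.2},
      ((n : ℝ) - (ρ (c x q.1.1 q.1.2 * finTorusPlaquette U x q.1.1 q.1.2)).trace.re))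
    ∂(Measure.pi fun _ : FinTorusSite n₀ n₁ n₂ n₃ × Fin 4 => haarProbability G)

/-- **'t Hooft's twisted functional integral `W{n_{μν}; a_μ}` on the anisotropic lattice box**, all six twists:
the Wilson integral with the plaquette twist `tHooftTwistTensor z`. [cite: tHooft1979Flux, §2 (2.5)–(2.6)]
[cite: Greensite2011, §4.4 (4.41)–(4.44)] -/
def wilsonFinTorusTensorTwistedPartition (β : ℝ) (z : Fin 4 → Fin 4 → G) (n₀ n₁ n₂ n₃ : ℕ) : ℝ :=
  wilsonFinTorusPlaqTwistedPartition ρ β n₀ n₁ n₂ n₃ (tHooftTwistTensor z)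

/-- Unfolding lemma. [cite: tHooft1979Flux, §2 (2.6)] -/
theorem wilsonFinTorusTensorTwistedPartition_def (β : ℝ) (z : Fin 4 → Fin 4 → G) (n₀ n₁ n₂ n₃ : ℕ) :
    wilsonFinTorusTensorTwistedPartition ρ β z n₀ n₁ n₂ n₃ =
      wilsonFinTorusPlaqTwistedPartition ρ β n₀ n₁ n₂ n₃ (tHooftTwistTensor z) := rfl

/-- **The temporally twisted partition function of the companion files is the plaquette-twisted one with
`c = tHooftTwistFactor z`** (definitionally). [cite: tHooft1979Flux, §2 (2.6)] -/
theorem wilsonFinTorusTwistedPartition_eq_plaqTwisted (β : ℝ) (z : Fin 4 → G) (n₀ n₁ n₂ n₃ : ℕ) :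
    wilsonFinTorusTwistedPartition ρ β z n₀ n₁ n₂ n₃ =
      wilsonFinTorusPlaqTwistedPartition ρ β n₀ n₁ n₂ n₃ (fun x μ ν => tHooftTwistFactor z x μ ν) := rfl

/-- **No magnetic twist: `W{k, m = 0; a_μ}` is the temporally twisted partition function** — the twist tensor of a
temporal family has the same stacks as `tHooftTwistFactor`. [cite: tHooft1979Flux, §2 (2.5)–(2.6)] -/
theorem wilsonFinTorusTensorTwistedPartition_temporal (β : ℝ) (zT : Fin 4 → G) (n₀ n₁ n₂ n₃ : ℕ) :
    wilsonFinTorusTensorTwistedPartition ρ β (temporalTwistTensor zT) n₀ n₁ n₂ n₃ =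
      wilsonFinTorusTwistedPartition ρ β zT n₀ n₁ n₂ n₃ := by
  unfold wilsonFinTorusTensorTwistedPartition wilsonFinTorusPlaqTwistedPartition wilsonFinTorusTwistedPartition
  refine integral_congr_ae (ae_of_all _ fun U => ?_)
  simp only
  congr 1; congr 1
  refine Finset.sum_congr rfl fun x _ => Finset.sum_congr rfl fun q _ => ?_
  rw [tHooftTwistTensor_temporal_of_lt zT x q.2]

omit [CompactSpace G] [MeasurableSpace G] [BorelSpace G] in
/-- Continuity of the plaquette-twisted Wilson weight in the links. [cite: MontvayMunster1994, §3.2.2 (3.65)] -/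
theorem continuous_finTorusPlaqTwistedWeight (hρ : Continuous ρ) (β : ℝ) {n₀ n₁ n₂ n₃ : ℕ}
    (c : FinTorusSite n₀ n₁ n₂ n₃ → Fin 4 → Fin 4 → G) :
    Continuous fun U : FinTorusSite n₀ n₁ n₂ n₃ × Fin 4 → G =>
      Real.exp (-β * ∑ x : FinTorusSite n₀ n₁ n₂ n₃, ∑ q : {q : Fin 4 × Fin 4 // q.1 < q.2},
        ((n : ℝ) - (ρ (c x q.1.1 q.1.2 * finTorusPlaquette U x q.1.1 q.1.2)).trace.re)) := by
  have hU : ∀ l : FinTorusSite n₀ n₁ n₂ n₃ × Fin 4,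
      Continuous fun U : FinTorusSite n₀ n₁ n₂ n₃ × Fin 4 → G => U l := fun l => continuous_apply l
  have hpl : ∀ (x : FinTorusSite n₀ n₁ n₂ n₃) (μ ν : Fin 4),
      Continuous fun U : FinTorusSite n₀ n₁ n₂ n₃ × Fin 4 → G => finTorusPlaquette U x μ ν := fun x μ ν =>
    (((hU _).mul (hU _)).mul (hU _).inv).mul (hU _).inv
  have htr : Continuous fun g : G => (ρ g).trace.re := Complex.continuous_re.comp (Continuous.matrix_trace hρ)
  exact Real.continuous_exp.comp (continuous_const.mul (continuous_finsetSum _ fun x _ =>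
    continuous_finsetSum _ fun q _ => continuous_const.sub (htr.comp (continuous_const.mul (hpl x _ _)))))

/-- **The plaquette-twisted partition function is strictly positive.** [cite: tHooft1979Flux, §2 (2.6)] -/
theorem wilsonFinTorusPlaqTwistedPartition_pos [SecondCountableTopology G] (hρ : Continuous ρ) (β : ℝ)
    (n₀ n₁ n₂ n₃ : ℕ) (c : FinTorusSite n₀ n₁ n₂ n₃ → Fin 4 → Fin 4 → G) :
    0 < wilsonFinTorusPlaqTwistedPartition ρ β n₀ n₁ n₂ n₃ c := by
  unfold wilsonFinTorusPlaqTwistedPartition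
  exact integral_exp_pos ((continuous_finTorusPlaqTwistedWeight ρ hρ β c).integrable_of_hasCompactSupport
    (IsCompact.of_isClosed_subset isCompact_univ (isClosed_tsupport _) (Set.subset_univ _)))

/-- `W{n_{μν}; a_μ} > 0`. [cite: tHooft1979Flux, §2 (2.6)] -/
theorem wilsonFinTorusTensorTwistedPartition_pos [SecondCountableTopology G] (hρ : Continuous ρ) (β : ℝ)
    (z : Fin 4 → Fin 4 → G) (n₀ n₁ n₂ n₃ : ℕ) : 0 < wilsonFinTorusTensorTwistedPartition ρ β z n₀ n₁ n₂ n₃ :=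
  wilsonFinTorusPlaqTwistedPartition_pos ρ hρ β n₀ n₁ n₂ n₃ _

end Partition

/-! ### Covariant axis relabelling for arbitrary plaquette twists -/

section Relabel

variable (ρ : G →* Matrix (Fin n) (Fin n) ℂ) [TopologicalSpace G] [IsTopologicalGroup G] [CompactSpace G]
  [MeasurableSpace G] [BorelSpace G]

omit [MeasurableSpace G] [BorelSpace G] in
/-- The oriented twisted plaquette term is symmetric under orientation reversal (`U_{νμ} = U_{μν}⁻¹`,
`c(ν,μ) = c(μ,ν)⁻¹`, `Re tr ρ(g⁻¹) = Re tr ρ(g)`, cyclicity). [cite: tHooft1979Flux, §2 (2.5)–(2.6)] -/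
theorem re_trace_plaqTwistCocycle_mul_symm (hρ : Continuous ρ) {n₀ n₁ n₂ n₃ : ℕ}
    (c : FinTorusSite n₀ n₁ n₂ n₃ → Fin 4 → Fin 4 → G) (U : FinTorusSite n₀ n₁ n₂ n₃ × Fin 4 → G)
    (x : FinTorusSite n₀ n₁ n₂ n₃) (μ ν : Fin 4) :
    (ρ (plaqTwistCocycle c x ν μ * finTorusPlaquette U x ν μ)).trace.re =
      (ρ (plaqTwistCocycle c x μ ν * finTorusPlaquette U x μ ν)).trace.re := by
  rw [plaqTwistCocycle_symm c x μ ν, finTorusPlaquette_symm'' U x μ ν, ← mul_inv_rev,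
    CompactGroup.re_trace_map_inv ρ hρ, map_mul, map_mul, Matrix.trace_mul_comm]

omit [MeasurableSpace G] [BorelSpace G] in
/-- **The plaquette-twisted Wilson exponent is covariant under axis relabelling**: a site bijection `e` intertwining the
shifts along an axis permutation `σ`, with corresponding oriented cocycles `c'(e x; σμ, σν) = c(x; μ, ν)`, carries the
twisted action of the pulled-back configuration `U' ∘ (e × σ)` with twist `c` to the twisted action of `U'` with twist `c'`.
[cite: tHooft1979Flux, §2 (2.6) and §6 (6.1)–(6.2)] -/
theorem sum_plaqTwistedTerm_relabel (hρ : Continuous ρ) {a b c d a' b' c' d' : ℕ}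
    (e : FinTorusSite a b c d ≃ FinTorusSite a' b' c' d') (σ : Equiv.Perm (Fin 4))
    (he : ∀ x μ, e (x.shift μ) = (e x).shift (σ μ)) {tw : FinTorusSite a b c d → Fin 4 → Fin 4 → G}
    {tw' : FinTorusSite a' b' c' d' → Fin 4 → Fin 4 → G}
    (hcov : ∀ x μ ν, plaqTwistCocycle tw' (e x) (σ μ) (σ ν) = plaqTwistCocycle tw x μ ν)
    (U' : FinTorusSite a' b' c' d' × Fin 4 → G) :
    (∑ x : FinTorusSite a b c d, ∑ q : {q : Fin 4 × Fin 4 // q.1 < q.2},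
        ((n : ℝ) - (ρ (tw x q.1.1 q.1.2 *
          finTorusPlaquette (fun l : FinTorusSite a b c d × Fin 4 => U' (e l.1, σ l.2)) x q.1.1 q.1.2)).trace.re)) =
      ∑ x' : FinTorusSite a' b' c' d', ∑ q : {q : Fin 4 × Fin 4 // q.1 < q.2},
        ((n : ℝ) - (ρ (tw' x' q.1.1 q.1.2 * finTorusPlaquette U' x' q.1.1 q.1.2)).trace.re) := by
  have hL : (∑ x : FinTorusSite a b c d, ∑ q : {q : Fin 4 × Fin 4 // q.1 < q.2},
      ((n : ℝ) - (ρ (tw x q.1.1 q.1.2 *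
        finTorusPlaquette (fun l : FinTorusSite a b c d × Fin 4 => U' (e l.1, σ l.2)) x q.1.1 q.1.2)).trace.re)) =
      ∑ x : FinTorusSite a b c d, ∑ q : {q : Fin 4 × Fin 4 // q.1 < q.2},
        ((n : ℝ) - (ρ (plaqTwistCocycle tw x q.1.1 q.1.2 *
          finTorusPlaquette U' (e x) (σ q.1.1) (σ q.1.2))).trace.re) :=
    Finset.sum_congr rfl fun x _ => Finset.sum_congr rfl fun q _ => by
      rw [plaqTwistCocycle_of_lt tw x q.2, finTorusPlaquette_relabel'' e σ he U']
  have hR : (∑ x' : FinTorusSite a' b' c' d', ∑ q : {q : Fin 4 × Fin 4 // q.1 < q.2},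
      ((n : ℝ) - (ρ (tw' x' q.1.1 q.1.2 * finTorusPlaquette U' x' q.1.1 q.1.2)).trace.re)) =
      ∑ x' : FinTorusSite a' b' c' d', ∑ q : {q : Fin 4 × Fin 4 // q.1 < q.2},
        ((n : ℝ) - (ρ (plaqTwistCocycle tw' x' q.1.1 q.1.2 * finTorusPlaquette U' x' q.1.1 q.1.2)).trace.re) :=
    Finset.sum_congr rfl fun x' _ => Finset.sum_congr rfl fun q _ => by
      rw [plaqTwistCocycle_of_lt tw' x' q.2]
  rw [hL, hR]
  calc (∑ x : FinTorusSite a b c d, ∑ q : {q : Fin 4 × Fin 4 // q.1 < q.2},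
        ((n : ℝ) - (ρ (plaqTwistCocycle tw x q.1.1 q.1.2 *
          finTorusPlaquette U' (e x) (σ q.1.1) (σ q.1.2))).trace.re))
      = ∑ x : FinTorusSite a b c d, ∑ q : {q : Fin 4 × Fin 4 // q.1 < q.2},
          ((n : ℝ) - (ρ (plaqTwistCocycle tw' (e x) (σ q.1.1) (σ q.1.2) *
            finTorusPlaquette U' (e x) (σ q.1.1) (σ q.1.2))).trace.re) := by
        simp_rw [hcov]
    _ = ∑ x' : FinTorusSite a' b' c' d', ∑ q : {q : Fin 4 × Fin 4 // q.1 < q.2},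
          ((n : ℝ) - (ρ (plaqTwistCocycle tw' x' (σ q.1.1) (σ q.1.2) *
            finTorusPlaquette U' x' (σ q.1.1) (σ q.1.2))).trace.re) :=
        Equiv.sum_comp e (fun x' => ∑ q : {q : Fin 4 × Fin 4 // q.1 < q.2},
          ((n : ℝ) - (ρ (plaqTwistCocycle tw' x' (σ q.1.1) (σ q.1.2) *
            finTorusPlaquette U' x' (σ q.1.1) (σ q.1.2))).trace.re))
    _ = ∑ x' : FinTorusSite a' b' c' d', ∑ q : {q : Fin 4 × Fin 4 // q.1 < q.2},
          ((n : ℝ) - (ρ (plaqTwistCocycle tw' x' q.1.1 q.1.2 * finTorusPlaquette U' x' q.1.1 q.1.2)).trace.re) :=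
        Finset.sum_congr rfl fun x' _ =>
          sum_pairs_perm'' (fun μ ν => (n : ℝ) - (ρ (plaqTwistCocycle tw' x' μ ν *
            finTorusPlaquette U' x' μ ν)).trace.re)
            (fun μ ν => by
              show ((n : ℝ) - (ρ (plaqTwistCocycle tw' x' ν μ * finTorusPlaquette U' x' ν μ)).trace.re) =
                (n : ℝ) - (ρ (plaqTwistCocycle tw' x' μ ν * finTorusPlaquette U' x' μ ν)).trace.re
              rw [re_trace_plaqTwistCocycle_mul_symm ρ hρ tw' U' x' μ ν]) σ

/-- **Covariant axis relabelling of plaquette-twisted integrals with an observable inserted**: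
`∫ Φ(U) w_c(U) ∏ dU = ∫ Φ(U' ∘ (e × σ)) w_{c'}(U') ∏ dU'` under the hypotheses of `sum_plaqTwistedTerm_relabel`
(the link relabelling preserves the product Haar measure). [cite: tHooft1979Flux, §2 (2.6) and §6 (6.1)–(6.2)]
[cite: MontvayMunster1994, §3.2.6 (3.145)] -/
theorem integral_mul_plaqTwistedWeight_relabel (hρ : Continuous ρ) (β : ℝ) {a b c d a' b' c' d' : ℕ}
    (e : FinTorusSite a b c d ≃ FinTorusSite a' b' c' d') (σ : Equiv.Perm (Fin 4))
    (he : ∀ x μ, e (x.shift μ) = (e x).shift (σ μ)) {tw : FinTorusSite a b c d → Fin 4 → Fin 4 → G}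
    {tw' : FinTorusSite a' b' c' d' → Fin 4 → Fin 4 → G}
    (hcov : ∀ x μ ν, plaqTwistCocycle tw' (e x) (σ μ) (σ ν) = plaqTwistCocycle tw x μ ν)
    (Φ : (FinTorusSite a b c d × Fin 4 → G) → ℝ) :
    ∫ U, Φ U * Real.exp (-β * ∑ x : FinTorusSite a b c d, ∑ q : {q : Fin 4 × Fin 4 // q.1 < q.2},
        ((n : ℝ) - (ρ (tw x q.1.1 q.1.2 * finTorusPlaquette U x q.1.1 q.1.2)).trace.re))
        ∂(Measure.pi fun _ : FinTorusSite a b c d × Fin 4 => haarProbability G) =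
      ∫ U', Φ (fun l : FinTorusSite a b c d × Fin 4 => U' (e l.1, σ l.2)) *
        Real.exp (-β * ∑ x' : FinTorusSite a' b' c' d', ∑ q : {q : Fin 4 × Fin 4 // q.1 < q.2},
          ((n : ℝ) - (ρ (tw' x' q.1.1 q.1.2 * finTorusPlaquette U' x' q.1.1 q.1.2)).trace.re))
        ∂(Measure.pi fun _ : FinTorusSite a' b' c' d' × Fin 4 => haarProbability G) := by
  have hΨ : MeasurePreserving
      (MeasurableEquiv.arrowCongr' (e.prodCongr σ).symm (MeasurableEquiv.refl G) :
        (FinTorusSite a' b' c' d' × Fin 4 → G) → (FinTorusSite a b c d × Fin 4 → G))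
      (Measure.pi fun _ : FinTorusSite a' b' c' d' × Fin 4 => haarProbability G)
      (Measure.pi fun _ : FinTorusSite a b c d × Fin 4 => haarProbability G) :=
    measurePreserving_arrowCongr' (fun _ => haarProbability G) (fun _ => haarProbability G)
      (e.prodCongr σ).symm (MeasurableEquiv.refl G) fun _ => MeasurePreserving.id _
  have hΨU : ∀ U' : FinTorusSite a' b' c' d' × Fin 4 → G,
      (MeasurableEquiv.arrowCongr' (e.prodCongr σ).symm (MeasurableEquiv.refl G) U' :
        FinTorusSite a b c d × Fin 4 → G) = fun l => U' (e l.1, σ l.2) := fun U' => by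
    funext l
    rfl
  refine (Eq.trans (integral_congr_ae (ae_of_all _ fun U' => ?_)) (hΨ.integral_comp'
    (fun U : FinTorusSite a b c d × Fin 4 → G => Φ U * Real.exp (-β * ∑ x : FinTorusSite a b c d,
      ∑ q : {q : Fin 4 × Fin 4 // q.1 < q.2},
        ((n : ℝ) - (ρ (tw x q.1.1 q.1.2 * finTorusPlaquette U x q.1.1 q.1.2)).trace.re))))).symm
  rw [hΨU U', sum_plaqTwistedTerm_relabel ρ hρ e σ he hcov U']

/-- **Covariant axis relabelling of the plaquette-twisted partition function**: under a site bijection intertwining the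
shifts along an axis permutation and a correspondence of the oriented cocycles, `Z^{c}(a,b,c,d) = Z^{c'}(a',b',c',d')` —
't Hooft's «W will be invariant under joint rotations of a_μ and n_{μν}», for arbitrary plaquette twists.
[cite: tHooft1979Flux, §2 (2.6) and §6 (6.1)–(6.2)] [cite: MontvayMunster1994, §3.2.6 (3.145)] -/
theorem wilsonFinTorusPlaqTwistedPartition_relabel (hρ : Continuous ρ) (β : ℝ) {a b c d a' b' c' d' : ℕ}
    (e : FinTorusSite a b c d ≃ FinTorusSite a' b' c' d') (σ : Equiv.Perm (Fin 4))
    (he : ∀ x μ, e (x.shift μ) = (e x).shift (σ μ)) {tw : FinTorusSite a b c d → Fin 4 → Fin 4 → G}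
    {tw' : FinTorusSite a' b' c' d' → Fin 4 → Fin 4 → G}
    (hcov : ∀ x μ ν, plaqTwistCocycle tw' (e x) (σ μ) (σ ν) = plaqTwistCocycle tw x μ ν) :
    wilsonFinTorusPlaqTwistedPartition ρ β a b c d tw = wilsonFinTorusPlaqTwistedPartition ρ β a' b' c' d' tw' := by
  have h := integral_mul_plaqTwistedWeight_relabel ρ hρ β e σ he hcov fun _ => (1 : ℝ)
  simp only [one_mul] at h
  exact h

/-! ### 't Hooft's twist tensor under axis exchange: electric and magnetic twists mix -/

/-- ★ **The cube step mixes electric and magnetic twists.**  Exchanging the axes `0 ↔ 3` of the anisotropic box (site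
bijection `(x₀,x₁,x₂,x₃) ↦ (x₃,x₁,x₂,x₀)`; the side `a` read as Euclidean time):
`W{z}(a,b,c,d) = W{swap03TwistTensor z}(d,b,c,a)` — the electric twists of the planes `(1,3), (2,3)` become the
magnetic twists of `(0,1), (0,2)` (inverted) and conversely, the `(0,3)` twist is inverted, the `(1,2)` twist is kept.
Every `z : Fin 4 → Fin 4 → G`, compact `G`, continuous `ρ`, real `β`; no centrality (a change of variables).
[cite: tHooft1979Flux, §6 (6.1)–(6.2)] [cite: Greensite2011, §4.4 (4.43)–(4.44)] -/
theorem wilsonFinTorusTensorTwistedPartition_swap03 (hρ : Continuous ρ) (β : ℝ) (z : Fin 4 → Fin 4 → G)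
    (a b c d : ℕ) :
    wilsonFinTorusTensorTwistedPartition ρ β z a b c d =
      wilsonFinTorusTensorTwistedPartition ρ β (swap03TwistTensor z) d b c a :=
  wilsonFinTorusPlaqTwistedPartition_relabel ρ hρ β
    (⟨fun x => (x.2.2.2, x.2.1, x.2.2.1, x.1), fun y => (y.2.2.2, y.2.1, y.2.2.1, y.1), fun _ => rfl, fun _ => rfl⟩ :
      FinTorusSite a b c d ≃ FinTorusSite d b c a)
    (Equiv.swap 0 3) (fun x μ => by fin_cases μ <;> rfl)
    (fun x μ ν => plaqTwistCocycle_swap03TwistTensor z x μ ν)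

/-- ★ **The lattice form of 't Hooft's (6.2).**  Under the axis exchange `0 ↔ 1`, `2 ↔ 3` (site bijection
`(x₀,x₁,x₂,x₃) ↦ (x₁,x₀,x₃,x₂)` — his rotation (6.1): `ã ↦ â`, `(a₃, β) ↦ (β, a₃)`):
`W{z}(a,b,c,d) = W{rotateTwistTensor z}(b,a,d,c)`, i.e. the two transverse electric twists (`z 0 3, z 1 3` = `k̃`) and the
two transverse magnetic twists (`z 1 2, z 0 2` = `m̃`) are exchanged and the longitudinal ones (`z 2 3 = k₃`, `z 0 1 = m₃`)
are inverted: «W{k̃, k₃, m̃, m₃; ã, a₃, β} = W{m̃, k₃, k̃, m₃; â, β, a₃}» up to the two inversions, which 't Hooft's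
coordinate reflections in (6.1) undo for central twists (and which are vacuous for `ℤ₂` twists).  Every `z`, compact `G`,
continuous `ρ`, real `β`. [cite: tHooft1979Flux, §6 (6.1)–(6.2)] -/
theorem wilsonFinTorusTensorTwistedPartition_rotate (hρ : Continuous ρ) (β : ℝ) (z : Fin 4 → Fin 4 → G)
    (a b c d : ℕ) :
    wilsonFinTorusTensorTwistedPartition ρ β z a b c d =
      wilsonFinTorusTensorTwistedPartition ρ β (rotateTwistTensor z) b a d c :=
  wilsonFinTorusPlaqTwistedPartition_relabel ρ hρ β
    (⟨fun x => (x.2.1, x.1, x.2.2.2, x.2.2.1), fun y => (y.2.1, y.1, y.2.2.2, y.2.2.1), fun _ => rfl, fun _ => rfl⟩ :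
      FinTorusSite a b c d ≃ FinTorusSite b a d c)
    (Equiv.swap (0 : Fin 4) 1 * Equiv.swap (2 : Fin 4) 3) (fun x μ => by fin_cases μ <;> rfl)
    (fun x μ ν => plaqTwistCocycle_rotateTwistTensor z x μ ν)

end Relabel

end Literature.MathematicalPhysics.QuantumFieldTheory

end
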